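import Literature.MeasureTheory.RestrictedProduct.LevelMeasure
import Mathlib.Topology.Algebra.RestrictedProduct.Basic

/-!
# Restricted product measures, II: gluing the levels; the measurable space `Πʳ i, [G i, K i]` and its measure

Topic `MeasureTheory/RestrictedProduct`; continues `LevelMeasure` (Tate's thesis, Cassels–Fröhlich (1967) Ch. XV
§3.3, PDF pp. 352–353 [CasselsFrohlichANT1967]; Leahy (2010) Prop. 3.1.8). Where Tate glues the product measures
`dα_S` on the open subgroups `G_S` by the a-priori existence of a Haar measure on `G`, this file glues the level
measures `λ_S` EXPLICITLY (no local compactness, no group structure):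

* `shell K S₀ T = {x | {i ∉ S₀ | x_i ∉ K_i} = T}` — the shells; disjoint, measurable, `shell T ⊆ A_{S₀ ∪ T}`;
* `glued K ν S₀ = Σ_T λ_{S₀ ∪ T}|_{shell T}`; `glued_restrict_box` — `Λ|_{A_S} = λ_S` for EVERY finite `S ⊇ S₀`;
* `instMeasurableSpace` — the measurable structure on Mathlib's `RestrictedProduct G K cofinite = Πʳ i, [G i, K i]`:
  the trace of the product σ-algebra along the coercion (DESIGN CHOICE, the one global instance of this file:
  Mathlib has no `MeasurableSpace` instance on `RestrictedProduct`; for second countable factors this trace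
  σ-algebra is the Borel σ-algebra of Mathlib's restricted-product topology, so it is compatible with
  `[BorelSpace]` hypotheses);
* `incl`, `measurableEmbedding_incl` — the coercion is a measurable embedding with measurable range `⋃_S A_S`;
* `rpBox K S` — the cylinder `A_S` inside the restricted product; `rpMeasure K ν S₀` — THE RESTRICTED PRODUCT
  MEASURE `∏'_i (ν_i ; K_i)` (pull-back of `glued`).

Everything is proved (Mathlib only). The product formula `μ|_{A_S} = (e_S)_* ((∏_{i∈S} ν_i) ⊗ ρ_S)`, uniqueness
and σ-finiteness are in `ProductMeasureRestrict`.

## Provenance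

Reproduced for the tree under the LEAN-IN-TREE rule (2026-08-18) from the pub-hodgecm cell's package file
`HodgeCM/PerL34/RestrictedMeasure.lean` (seat pv09-g2, gate run 22), part 2 of 3, verbatim up to the namespace
(`HodgeCM.PerL34.RestrictedMeasure` ↦ `Literature.MeasureTheory.RestrictedProduct`) and the added docstrings.
-/

set_option autoImplicit false

noncomputable section

open _root_.MeasureTheory Filter Set Function
open scoped Classical ENNReal
open scoped RestrictedProduct

namespace Literature.MeasureTheory.RestrictedProduct

universe u v

variable {ι : Type u} {G : ι → Type v} [∀ i, MeasurableSpace (G i)]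
variable (K : ∀ i, Set (G i)) (ν : ∀ i, Measure (G i))

/-! ### Gluing the levels over the shells `{x | bad(x) = T}` -/

section glue

variable (S₀ : Finset ι)

/-- The shell of points whose set of bad coordinates (`i ∉ S₀`, `x_i ∉ K_i`) is exactly `T`. [folklore] -/
def shell (T : Finset ι) : Set (Π i, G i) := {x | ∀ i, (i ∉ S₀ ∧ x i ∉ K i) ↔ i ∈ T}

omit [∀ i, MeasurableSpace (G i)] in
/-- Distinct shells are disjoint. [folklore] -/
theorem shell_disjoint {T T' : Finset ι} (h : T ≠ T') : Disjoint (shell K S₀ T) (shell K S₀ T') :=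
  Set.disjoint_left.2 fun _ hx hx' => h (Finset.ext fun i => (hx i).symm.trans (hx' i))

omit [∀ i, MeasurableSpace (G i)] in
/-- The shell `bad = T` lies in the cylinder `A_{S₀ ∪ T}`. [folklore] -/
theorem shell_subset_box (T : Finset ι) : shell K S₀ T ⊆ box K (S₀ ∪ T) := by
  intro x hx i hi
  rw [Finset.mem_union, not_or] at hi
  by_contra h
  exact hi.2 ((hx i).1 ⟨hi.1, h⟩)

omit [∀ i, MeasurableSpace (G i)] in
/-- The cylinder `A_S` misses every shell `bad = T` with `T ⊄ S`. [folklore] -/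
theorem box_inter_shell_eq_empty {S T : Finset ι} (h : ¬ T ⊆ S) : box K S ∩ shell K S₀ T = ∅ := by
  obtain ⟨i, hiT, hiS⟩ := Finset.not_subset.1 h
  refine Set.eq_empty_of_forall_notMem fun x hx => ?_
  exact ((hx.2 i).2 hiT).2 (hx.1 i hiS)

omit [∀ i, MeasurableSpace (G i)] in
/-- The cylinder `A_S` is the union of its traces on the shells. [folklore] -/
theorem iUnion_box_inter_shell (S : Finset ι) :
    (⋃ T : Finset ι, box K S ∩ shell K S₀ T) = box K S := by
  refine subset_antisymm (iUnion_subset fun T => inter_subset_left) fun x hx => ?_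
  refine mem_iUnion.2 ⟨S.filter fun i => i ∉ S₀ ∧ x i ∉ K i, hx, fun i => ?_⟩
  rw [Finset.mem_filter]
  refine ⟨fun h => ⟨?_, h⟩, fun h => h.2⟩
  by_contra hiS
  exact h.2 (hx i hiS)

/-- Shells are measurable. [folklore] -/
theorem measurableSet_shell [Countable ι] (hKm : ∀ i, MeasurableSet (K i)) (T : Finset ι) :
    MeasurableSet (shell K S₀ T) := by
  have : shell K S₀ T = ⋂ i, {x : Π i, G i | (i ∉ S₀ ∧ x i ∉ K i) ↔ i ∈ T} := by
    ext x; simp [shell, mem_iInter]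
  rw [this]
  refine MeasurableSet.iInter fun i => ?_
  have hm : MeasurableSet {x : Π i, G i | x i ∈ K i} := measurable_pi_apply i (hKm i)
  by_cases hT : i ∈ T <;> by_cases h0 : i ∈ S₀
  · have : {x : Π i, G i | (i ∉ S₀ ∧ x i ∉ K i) ↔ i ∈ T} = ∅ := by
      ext x; simp [hT, h0]
    rw [this]; exact MeasurableSet.empty
  · have : {x : Π i, G i | (i ∉ S₀ ∧ x i ∉ K i) ↔ i ∈ T} = {x | x i ∈ K i}ᶜ := by
      ext x; simp [hT, h0]
    rw [this]; exact hm.compl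
  · have : {x : Π i, G i | (i ∉ S₀ ∧ x i ∉ K i) ↔ i ∈ T} = univ := by
      ext x; simp [hT, h0]
    rw [this]; exact MeasurableSet.univ
  · have : {x : Π i, G i | (i ∉ S₀ ∧ x i ∉ K i) ↔ i ∈ T} = {x | x i ∈ K i} := by
      ext x; simp [hT, h0]
    rw [this]; exact hm

/-- The glued measure on `Π i, G i`: on the shell `bad = T` it is the level `S₀ ∪ T`. [folklore] -/
def glued : Measure (Π i, G i) :=
  Measure.sum fun T : Finset ι => (level K ν (S₀ ∪ T)).restrict (shell K S₀ T)

variable [Countable ι] [∀ i, SigmaFinite (ν i)]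

/-- **The glued measure restricted to `A_S` is the level-`S` product measure** (`S ⊇ S₀`). [cite: CasselsFrohlichANT1967, Ch. XV (Tate) §3.3, PDF pp. 352–353] -/
theorem glued_restrict_box (hKm : ∀ i, MeasurableSet (K i)) (hK1 : ∀ i, i ∉ S₀ → ν i (K i) = 1)
    {S : Finset ι} (hS : S₀ ⊆ S) : (glued K ν S₀).restrict (box K S) = level K ν S := by
  have hpS : ∀ i, i ∉ S → IsProbabilityMeasure (locK K ν i) := fun i hi =>
    isProbabilityMeasure_locK K ν (hK1 i fun h' => hi (hS h'))
  rw [glued, Measure.restrict_sum _ (measurableSet_box K hKm S)]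
  have hterm : (fun T : Finset ι => ((level K ν (S₀ ∪ T)).restrict (shell K S₀ T)).restrict (box K S))
      = fun T => (level K ν S).restrict (box K S ∩ shell K S₀ T) := by
    funext T
    rw [Measure.restrict_restrict (measurableSet_box K hKm S)]
    by_cases hT : T ⊆ S
    · rw [← level_restrict_box K ν hKm hK1 Finset.subset_union_left (Finset.union_subset hS hT),
        Measure.restrict_restrict ((measurableSet_box K hKm S).inter (measurableSet_shell K S₀ hKm T))]
      congr 1
      exact Set.inter_eq_left.2 fun x hx => shell_subset_box K S₀ T hx.2
    · rw [box_inter_shell_eq_empty K S₀ hT, Measure.restrict_empty, Measure.restrict_empty]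
  rw [hterm, ← Measure.restrict_iUnion
      (fun T T' hne => (shell_disjoint K S₀ hne).mono inter_subset_right inter_subset_right)
      (fun T => (measurableSet_box K hKm S).inter (measurableSet_shell K S₀ hKm T)),
    iUnion_box_inter_shell K S₀ S, Measure.restrict_eq_self_of_ae_mem (ae_level_mem_box K ν hKm S hpS)]

end glue

/-! ### The restricted product `Πʳ i, [G i, K i]` as a measurable space, and its measure -/

section restricted

/-- The measurable structure on the restricted product: the trace of the product σ-algebra. [folklore] -/
instance instMeasurableSpace : MeasurableSpace (Πʳ i, [G i, K i]) :=
  inferInstanceAs (MeasurableSpace {x : Π i, G i // ∀ᶠ i in cofinite, x i ∈ K i})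

/-- The inclusion `Πʳ i, [G i, K i] → Π i, G i` (the coercion, named for rewriting). [folklore] -/
def incl : (Πʳ i, [G i, K i]) → (Π i, G i) := fun x i => x i

omit [∀ i, MeasurableSpace (G i)] in
/-- Coordinates of the inclusion. [folklore] -/
@[simp] theorem incl_apply (x : Πʳ i, [G i, K i]) (i : ι) : incl K x i = x i := rfl

omit [∀ i, MeasurableSpace (G i)] in
/-- The range of the inclusion is the set of eventually-in-`K` points (Mathlib `RestrictedProduct.range_coe`). [folklore] -/
theorem range_incl : range (incl K) = {x : Π i, G i | ∀ᶠ i in cofinite, x i ∈ K i} :=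
  RestrictedProduct.range_coe _ _

omit [∀ i, MeasurableSpace (G i)] in
/-- The eventually-in-`K` points of `Π i, G i` are the union of the cylinders `A_S`. [folklore] -/
theorem setOf_eventually_eq_iUnion_box :
    {x : Π i, G i | ∀ᶠ i in cofinite, x i ∈ K i} = ⋃ S : Finset ι, box K S := by
  ext x
  rw [mem_setOf_eq, mem_iUnion, Filter.eventually_cofinite]
  constructor
  · intro hfin
    exact ⟨hfin.toFinset, fun i hi => by_contra fun h => hi (hfin.mem_toFinset.2 h)⟩
  · rintro ⟨S, hS⟩
    exact S.finite_toSet.subset fun i hi => by_contra fun h => hi (hS i h)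

omit [∀ i, MeasurableSpace (G i)] in
/-- Every cylinder `A_S ⊆ Π i, G i` lies in the range of the inclusion. [folklore] -/
theorem box_subset_range_incl (S : Finset ι) : box K S ⊆ range (incl K) := by
  rw [range_incl, setOf_eventually_eq_iUnion_box]
  exact subset_iUnion (fun S => box K S) S

/-- The inclusion `Πʳ i, [G i, K i] → Π i, G i` is a measurable embedding with measurable range (countably many measurable `K i`). [folklore] -/
theorem measurableEmbedding_incl [Countable ι] (hKm : ∀ i, MeasurableSet (K i)) :
    MeasurableEmbedding (incl K) := by
  have hR : MeasurableSet {x : Π i, G i | ∀ᶠ i in cofinite, x i ∈ K i} := by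
    rw [setOf_eventually_eq_iUnion_box]
    exact MeasurableSet.iUnion fun S => measurableSet_box K hKm S
  exact MeasurableEmbedding.subtype_coe hR

/-- The cylinder `A_S = {x | x_i ∈ K_i for i ∉ S}` in the restricted product. [folklore] -/
def rpBox (S : Finset ι) : Set (Πʳ i, [G i, K i]) := {x | ∀ i, i ∉ S → x i ∈ K i}

omit [∀ i, MeasurableSpace (G i)] in
/-- `rpBox K S` is the preimage of the cylinder `box K S` under the inclusion. [folklore] -/
theorem rpBox_eq (S : Finset ι) : rpBox K S = incl K ⁻¹' box K S := rfl

omit [∀ i, MeasurableSpace (G i)] in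
/-- The cylinders of the restricted product increase with `S`. [folklore] -/
theorem rpBox_mono {S S' : Finset ι} (h : S ⊆ S') : rpBox K S ⊆ rpBox K S' :=
  fun _ hx i hi => hx i fun h' => hi (h h')

omit [∀ i, MeasurableSpace (G i)] in
/-- Every point of the restricted product lies in some cylinder `A_S`. [folklore] -/
theorem exists_mem_rpBox (x : Πʳ i, [G i, K i]) : ∃ S : Finset ι, x ∈ rpBox K S := by
  have hx : incl K x ∈ ⋃ S : Finset ι, box K S := by
    rw [← setOf_eventually_eq_iUnion_box, ← range_incl]; exact mem_range_self x
  obtain ⟨S, hS⟩ := mem_iUnion.1 hx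
  exact ⟨S, hS⟩

/-- The cylinders of the restricted product are measurable. [folklore] -/
theorem measurableSet_rpBox [Countable ι] (hKm : ∀ i, MeasurableSet (K i)) (S : Finset ι) :
    MeasurableSet (rpBox K S) :=
  (measurableEmbedding_incl K hKm).measurable (measurableSet_box K hKm S)

/-- **The restricted product measure** `∏'_i (ν_i ; K_i)` on `Πʳ i, [G i, K i]` (exceptional set `S₀`). [cite: CasselsFrohlichANT1967, Ch. XV (Tate) §3.3, PDF pp. 352–353] -/
def rpMeasure (S₀ : Finset ι) : Measure (Πʳ i, [G i, K i]) := Measure.comap (incl K) (glued K ν S₀)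

end restricted

end Literature.MeasureTheory.RestrictedProduct

end
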